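import Summits.NavierStokesRegularity.NavierStokesRegularity.Theorems.SelfMixingDichotomyMixingPayoffAdvectionDiffusionUnique
import Literature.Analysis.FluidPDE.RapidDecayLemmas
import HarnessLib

/-!
# Crux `SelfMixingDichotomy.CoherentScaleExclusion` (stmt-NavierStokesRegularity-1423), line `registered`:
# stub SW4 `stub_heatSolution_unique` — uniqueness of admissible heat solutions on a window

Support file (`--supports stmt-NavierStokesRegularity-1423`) of the line lead c3 for the amplitude-free
coherence package (sphere-tangential drifts never stir radial blobs). "Admissible" heat evolutions on a
window `[a, b]` are jointly `C^∞` on the closed slab (`IsSmoothSpaceTimeOn (Icc a b) θ`), have uniform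
rapid decay of all within-slab derivatives (`HasUniformRapidDecayOn (Icc a b) θ`) and solve `∂ₜθ = Δθ`
with the one-sided time derivative `timeDerivWithin (Icc a b)`. Two admissible solutions with the same
datum at `t = a` coincide on `[a, b] × ℝ³`.

Proof: the difference `w = θ₁ − θ₂` is continuous on the slab, has `C²` slices, is bounded (order-zero
decay bounds, `HasUniformRapidDecayOn.norm_le_rpow`), vanishes at `t = a`, and on `(a, b]` its left time
derivative (the within-`Icc a b` derivative restricted to `Iic t`, `Icc_mem_nhdsLE_of_mem`) equals
`Δw = Δθ₁ − Δθ₂` (`ContDiffAt.laplacian_sub`); the tree's bounded-class parabolic uniqueness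
`MixingPayoffBirth.eq_zero_of_linear_parabolic` (`…MixingPayoffAdvectionDiffusionUnique`, Friedman 1964,
Ch. 2 §4 Thm. 10, bounded case) with zero drift `β = 0` and zero potential `γ = 0` gives `w = 0`.
-/

noncomputable section

open Set Function Filter
open _root_.Topology
open scoped Laplacian

-- `Summit = Problem` for this summit; the tree lakefile sets `weak.linter.dupNamespace = false`.
set_option linter.dupNamespace false

namespace Summit.NavierStokesRegularity.NavierStokesRegularity.Theorems

open Literature.Analysis.FluidPDE
open SelfMixingDichotomy.MixingPayoffBirth (eq_zero_of_linear_parabolic)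

/-- **SW4 — uniqueness of admissible heat solutions** (registered sub-goal `stub_heatSolution_unique` of
the crux `CoherentScaleExclusion`, line `registered`, lead c3). Two jointly smooth, uniformly rapidly
decaying solutions of `∂ₜθ = Δθ` on `[a, b] × ℝ³` (one-sided time derivative within `Icc a b`) with the
same datum at `t = a` coincide on the slab: the tree's bounded-class parabolic uniqueness
`eq_zero_of_linear_parabolic` with `β = 0`, `γ = 0`, applied to the difference. -/
theorem stub_heatSolution_unique :
    ∀ (a b : ℝ), a < b → ∀ (θ₁ θ₂ : ℝ → EuclideanSpace ℝ (Fin 3) → ℝ),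
      IsSmoothSpaceTimeOn (Set.Icc a b) θ₁ → HasUniformRapidDecayOn (Set.Icc a b) θ₁ →
      (∀ t ∈ Set.Icc a b, ∀ x : EuclideanSpace ℝ (Fin 3),
        timeDerivWithin (Set.Icc a b) θ₁ t x = Laplacian.laplacian (θ₁ t) x) →
      IsSmoothSpaceTimeOn (Set.Icc a b) θ₂ → HasUniformRapidDecayOn (Set.Icc a b) θ₂ →
      (∀ t ∈ Set.Icc a b, ∀ x : EuclideanSpace ℝ (Fin 3),
        timeDerivWithin (Set.Icc a b) θ₂ t x = Laplacian.laplacian (θ₂ t) x) →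
      θ₁ a = θ₂ a →
      ∀ t ∈ Set.Icc a b, ∀ x : EuclideanSpace ℝ (Fin 3), θ₁ t x = θ₂ t x := by
  intro a b _hab θ₁ θ₂ hs₁ hd₁ he₁ hs₂ hd₂ he₂ h0
  -- the difference `w = θ₁ - θ₂` and the zero coefficients
  set w : ℝ → EuclideanSpace ℝ (Fin 3) → ℝ := fun t x => θ₁ t x - θ₂ t x with hw
  set β : ℝ → EuclideanSpace ℝ (Fin 3) → EuclideanSpace ℝ (Fin 3) := fun _ _ => 0 with hβdef
  set γ : ℝ → EuclideanSpace ℝ (Fin 3) → ℝ := fun _ _ => 0 with hγdef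
  have hβ : ∀ t ∈ Icc a b, ∀ x : EuclideanSpace ℝ (Fin 3), ‖β t x‖ ≤ 0 := fun _ _ _ => by
    simp [hβdef]
  have hγ : ∀ t ∈ Icc a b, ∀ x : EuclideanSpace ℝ (Fin 3), |γ t x| ≤ 0 := fun _ _ _ => by
    simp [hγdef]
  -- continuity on the closed slab
  have hc : ContinuousOn (uncurry w) (Icc a b ×ˢ univ) := hs₁.continuousOn.sub hs₂.continuousOn
  -- `C²` slices
  have h2' : ∀ t ∈ Icc a b, ContDiff ℝ 2 (θ₁ t) ∧ ContDiff ℝ 2 (θ₂ t) := fun t ht =>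
    ⟨(hs₁.contDiff_slice ht).of_le (by norm_cast),
      (hs₂.contDiff_slice ht).of_le (by norm_cast)⟩
  have h2 : ∀ t ∈ Ioc a b, ContDiff ℝ 2 (w t) := fun t ht =>
    (h2' t (Ioc_subset_Icc_self ht)).1.sub (h2' t (Ioc_subset_Icc_self ht)).2
  -- the equation for the left time derivative on `(a, b]`
  have ht : ∀ t ∈ Ioc a b, ∀ x, HasDerivWithinAt (fun τ => w τ x)
      ((Δ (w t)) x + fderiv ℝ (w t) x (β t x) + γ t x * w t x) (Iic t) t := by
    intro t htI x
    have htc : t ∈ Icc a b := Ioc_subset_Icc_self htI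
    have heq₁ : derivWithin (fun s => θ₁ s x) (Icc a b) t = (Δ (θ₁ t)) x := he₁ t htc x
    have heq₂ : derivWithin (fun s => θ₂ s x) (Icc a b) t = (Δ (θ₂ t)) x := he₂ t htc x
    have h₁ : HasDerivWithinAt (fun s => θ₁ s x) ((Δ (θ₁ t)) x) (Icc a b) t :=
      heq₁ ▸ (hs₁.differentiableWithinAt_time htc x).hasDerivWithinAt
    have h₂ : HasDerivWithinAt (fun s => θ₂ s x) ((Δ (θ₂ t)) x) (Icc a b) t :=
      heq₂ ▸ (hs₂.differentiableWithinAt_time htc x).hasDerivWithinAt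
    have h := (h₁.sub h₂).mono_of_mem_nhdsWithin (Icc_mem_nhdsLE_of_mem htI)
    refine h.congr_deriv ?_
    have hc1 : ContDiffAt ℝ 2 (θ₁ t) x := (h2' t htc).1.contDiffAt
    have hc2 : ContDiffAt ℝ 2 (θ₂ t) x := (h2' t htc).2.contDiffAt
    rw [show w t = θ₁ t - θ₂ t from rfl, hc1.laplacian_sub hc2]
    simp [hβdef, hγdef]
  -- boundedness from the order-zero decay bounds
  obtain ⟨C₁, -, hC₁⟩ := hd₁.norm_le_rpow 0
  obtain ⟨C₂, -, hC₂⟩ := hd₂.norm_le_rpow 0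
  have hbd : ∀ t ∈ Icc a b, ∀ x, |w t x| ≤ C₁ + C₂ := fun t ht' x => by
    have h1 := hC₁ t ht' x
    have h2 := hC₂ t ht' x
    simp only [Nat.cast_zero, neg_zero, Real.rpow_zero, mul_one, Real.norm_eq_abs] at h1 h2
    simp only [hw]
    exact (abs_sub _ _).trans (add_le_add h1 h2)
  -- the initial slice vanishes
  have hw0 : ∀ x, w a x = 0 := fun x => by simp [hw, h0]
  have hz := eq_zero_of_linear_parabolic hβ hγ hc h2 ht hbd hw0
  intro t htI x
  have := hz t htI x
  simp only [hw] at this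
  linarith

end Summit.NavierStokesRegularity.NavierStokesRegularity.Theorems

end
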